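import Summits.Langlands.Langlands.Theorems.IrreducibilityBySelfDualityPairLBoundaryJSSsv
import Summits.Langlands.Langlands.Theorems.IrreducibilityBySelfDualityPairLBoundaryJSTransferMapLine
import Literature.NumberTheory.Automorphic.WhittakerCoeffTranslateNonvanishingOutside
import Literature.NumberTheory.Automorphic.WhittakerCoeffLevelOneTranslateNonvanishing
import Literature.NumberTheory.Automorphic.ArchRankinSelbergPairBridgeTranslate
import Literature.NumberTheory.Automorphic.BorelStabilizerLattice

/-!
# Crux `PairLBoundaryJS` (stmt-Langlands-13622), line `Sketch` — stub
# `stub_initialVector_translate_ne_zero` (W3): an initial pure tensor of level supported on `S₀`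
# whose translated transferred Whittaker functional is non-zero

Summit `Langlands`, sub-problem `Langlands`, helper file under `Theorems/` supporting the crux
`PairLBoundaryJS` (Arthur–Clozel (1989), Ch. 3, (2.2)), line `Sketch`, registered stub
`stub_initialVector_translate_ne_zero`.

Setting (tree vocabulary: `CuspidalRepFiniteComponent`, `WhittakerUniquenessReduction`,
`TransferMapLine`). `Π` is a cuspidal automorphic representation of `GL_n(𝔸_K)` (`n ≥ 1`) unramified
off the finite set `S₀`, `τ` its archimedean component (irreducible unitary, occurring in `Π`),
`M = multiplicityModule ≅ π_f` the smooth multiplicity module with its `GL_n(𝔸_K^∞)`-action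
`finComponentRep` (`g_f · S = R((1, g_f)) ∘ S`), `λ` the global Whittaker functional of `Π` and
`Φ_λ = transferMap λ`, `Φ_λ(S)(w) = λ(Ŝ w)`. For a torus element `t` trivial at `S₀` whose components
off `S₀` are Whittaker shifts correcting the conductor of Tate's character, the theorem produces a
level `𝔫₁` supported on `S₀`, an intertwiner `S₁ ∈ M` of level `K_f(𝔫₁)` and a Gårding vector `w` of
`τ` with `Φ_λ(t_f · S₁)(w) ≠ 0`.

Proof (Cogdell (2004), §1.1–§1.2 and §3.1; Shalika (1974), Thm. 5.9).
* A level `𝔫` supported on `S₀` with `Π^{K(𝔫)} ≠ 0` (`Ssv.stub_ssv`), a non-zero `K(𝔫)`-fixed `f₀` and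
  a left `K(𝔫)`-invariant test function `η` with `S_η f₀ ≠ 0` (Dirac approximation).
* Translated genericity and peeling OFF `S₀`
  (`exists_whittakerCoeff_smoothedForm_translate_ne_zero_forall_not_mem`): a point `g`, integral at
  every `v ∉ S₀`, with `W_{S_η f₀}(diag(t) g) ≠ 0`.
* `W_{S_η f₀}(x) = λ(R(x) y)`, `y = S_η f₀ ∈ Π^{K_f(𝔫)}` (`whittakerFunctional_toContRep_eq_whittakerCoeff`);
  expanding `y = Σ_i S_i (S_i† y)` in the level decomposition (`exists_levelPiece_decomposition`) gives
  `λ(R(x) y) = Σ_i Φ_λ(x_f · S_i)(τ(x_∞) e_i)` (`apply_toContRep_corestrictW_eq_transferMap`), so one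
  term is non-zero; with `x = diag(t) g`, `x_f · S_i = t_f · (g_f · S_i)`.
* The level of `S₁ = g_f · S_{i₀}`: `g_f K_f(𝔫) g_f⁻¹ ⊇ K_f(𝔫₁)` for `𝔫₁ = 𝔫 ∏_{v ∈ S₀} 𝔭_v^{k_v}`,
  because `K_v(𝔫)` is normal in `GL_n(𝒪_v)` at `v ∉ S₀` (where `g_v` is integral;
  `BigHeckeGLn.conj_mem_valuedCongruenceSubgroup`) and
  `g_v⁻¹ K_v(𝔭_v^{k_v}) g_v ⊆ K_v(𝔫)` for `k_v` large at `v ∈ S₀` (the `K_v(𝔭_v^m)` form a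
  neighbourhood basis of `1`, `exists_localCongruenceSubgroup_subset`).

## References

* J. W. Cogdell, *Analytic theory of L-functions for GL_n*, in *An Introduction to the Langlands
  Program* (2004), §1.1–§1.2, §3.1 Thm. 3.3 [CogdellAnalyticTheory2004].
* J. A. Shalika, *The multiplicity one theorem for GL_n*, Ann. of Math. 100 (1974), §5 Thm. 5.9
  [Shalika1974].
-/

noncomputable section

-- `Summit.Langlands.Langlands.…` (summit = sub-problem name, D-0017 layout) trips `dupNamespace`
set_option linter.dupNamespace false

open scoped MatrixGroups Topology Pointwise ENNReal NNReal ComplexConjugate InnerProductSpace ContDiff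
-- the place subtypes indexing `mixedSpace K` are `Fintype` classically (`NormedCommRing (mixedSpace K)`)
open scoped Classical Matrix.Norms.Operator
open NumberField IsDedekindDomain MeasureTheory Measure Matrix Set Filter WithZero
open NumberField.mixedEmbedding
open Literature.NumberTheory.Automorphic AdelicGroupData
open Literature.NumberTheory.GaloisRepresentations (ideleGroup HeckeCharacter)
open ValuativeRel

-- the automorphic quotient carries the tree's Borel σ-algebra, not Mathlib's quotient σ-algebra
attribute [-instance] Quotient.instMeasurableSpace QuotientGroup.measurableSpace

-- the house local instances, exactly as in `RankinSelbergUnfoldingIdentity`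
attribute [local instance] adelicBorel borelSpace_adelic locallyCompactSpace_adelic secondCountableTopology_gl_adelic
  glAdeleBorel borelSpace_glAdele borelSpace_ideleGroup secondCountableTopology_ideleGroup

-- Mathlib idiom: the commutator Lie ring on matrices, to mention `(archGroupGL n K).lie`
attribute [local instance 100] LieRing.ofAssociativeRing

namespace Summit.Langlands.Langlands.Theorems.InitialVectorTranslateNeZero

variable {n : ℕ} {K : Type} [Field K] [NumberField K]

/-! ### 1. Levels: conjugating `K_f(𝔫 ∏_{v ∈ S₀} 𝔭_v^{k_v})` into `K_f(𝔫)` -/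

/-- **Conjugation by a fixed `c ∈ GL_n(K_v)` maps a deep enough `K_v(𝔭_v^m)` into `K_v(R)`** (`R ≠ 0`):
`x ↦ c⁻¹ x c` is continuous, `K_v(R)` is an open neighbourhood of `1`, and the `K_v(𝔭_v^m)` form a
neighbourhood basis of `1` (`exists_localCongruenceSubgroup_subset`). [folklore] -/
theorem exists_forall_conj_mem_valuedCongruenceSubgroup (v : HeightOneSpectrum (𝓞 K))
    (c : GL (Fin n) (v.adicCompletion K)) {R : WithZero (Multiplicative ℤ)} (hR : R ≠ 0) :
    ∃ m : ℕ, ∀ x ∈ localCongruenceSubgroup n K v m, c⁻¹ * x * c ∈ valuedCongruenceSubgroup (Fin n) R := by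
  have hφc : Continuous fun x : GL (Fin n) (v.adicCompletion K) => c⁻¹ * x * c :=
    (continuous_const.mul continuous_id).mul continuous_const
  have hmem : (fun x : GL (Fin n) (v.adicCompletion K) => c⁻¹ * x * c) ⁻¹'
      ((valuedCongruenceSubgroup (Fin n) R : Subgroup (GL (Fin n) (v.adicCompletion K))) :
        Set (GL (Fin n) (v.adicCompletion K))) ∈ 𝓝 (1 : GL (Fin n) (v.adicCompletion K)) := by
    refine hφc.continuousAt.preimage_mem_nhds ?_
    rw [mul_one, inv_mul_cancel]
    exact (isOpen_valuedCongruenceSubgroup n K v hR).mem_nhds (one_mem _)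
  obtain ⟨m, hm⟩ := exists_localCongruenceSubgroup_subset n K v hmem
  exact ⟨m, fun x hx => hm hx⟩

/-- **The prime factors of `𝔫 ∏_{v ∈ S₀} 𝔭_v^{k_v}` are those of `𝔫` together with `S₀`.** [folklore] -/
theorem mem_of_dvd_mul_prod_pow {S₀ : Finset (HeightOneSpectrum (𝓞 K))} {𝔫 : Ideal (𝓞 K)}
    (hsupp : ∀ w : HeightOneSpectrum (𝓞 K), w.asIdeal ∣ 𝔫 → w ∈ S₀) (k : HeightOneSpectrum (𝓞 K) → ℕ)
    {w : HeightOneSpectrum (𝓞 K)} (hw : w.asIdeal ∣ 𝔫 * ∏ v ∈ S₀, v.asIdeal ^ k v) : w ∈ S₀ := by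
  rcases w.prime.dvd_or_dvd hw with h | h
  · exact hsupp w h
  · obtain ⟨v, hv, hdvd⟩ := w.prime.exists_mem_finset_dvd h
    have h1 : w.asIdeal ∣ v.asIdeal := w.prime.dvd_of_dvd_pow hdvd
    have h2 : v.asIdeal = w.asIdeal := v.isMaximal.eq_of_le w.isPrime.ne_top (Ideal.le_of_dvd h1)
    rwa [HeightOneSpectrum.ext h2.symm]

/-- **The level of a translate.** Let `g ∈ GL_n(𝔸_K)` be integral at every finite place outside the
finite set `S₀` and `𝔫 ≠ 0`. Then for suitable exponents `k`, with `𝔫₁ = 𝔫 ∏_{v ∈ S₀} 𝔭_v^{k_v}`,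
`g_f⁻¹ K_f(𝔫₁) g_f ≤ K_f(𝔫)`: at `v ∉ S₀`, `K_v(𝔫₁) ≤ K_v(𝔫)` is normalised by `GL_n(𝒪_v) ∋ g_v`; at
`v ∈ S₀`, `g_v⁻¹ K_v(𝔭_v^{k_v}) g_v ≤ K_v(𝔫)` for `k_v` large. [folklore] -/
theorem exists_forall_conj_mem_finitePrincipalCongruenceLevel (S₀ : Finset (HeightOneSpectrum (𝓞 K)))
    {𝔫 : Ideal (𝓞 K)} (h𝔫 : 𝔫 ≠ 0) {g : GL (Fin n) (AdeleRing (𝓞 K) K)}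
    (hg : ∀ v ∉ S₀, localComponent v g ∈ glInt n (v.adicCompletion K)) :
    ∃ k : HeightOneSpectrum (𝓞 K) → ℕ, 𝔫 * ∏ v ∈ S₀, v.asIdeal ^ k v ≠ 0 ∧
      ∀ u ∈ finitePrincipalCongruenceLevel n K (𝔫 * ∏ v ∈ S₀, v.asIdeal ^ k v),
        (GLn.sndHom n K g)⁻¹ * u * GLn.sndHom n K g ∈ finitePrincipalCongruenceLevel n K 𝔫 := by
  classical
  have hloc : ∀ v : HeightOneSpectrum (𝓞 K), ∃ m : ℕ, ∀ x ∈ localCongruenceSubgroup n K v m,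
      (GLn.localPart n K v g)⁻¹ * x * GLn.localPart n K v g ∈
        valuedCongruenceSubgroup (Fin n) (idealRadius K v 𝔫) := fun v =>
    exists_forall_conj_mem_valuedCongruenceSubgroup v _ (idealRadius_ne_zero v 𝔫)
  choose k hk using hloc
  have hne : 𝔫 * ∏ v ∈ S₀, v.asIdeal ^ k v ≠ 0 :=
    mul_ne_zero h𝔫 (Finset.prod_ne_zero_iff.2 fun v _ => pow_ne_zero _ v.ne_bot)
  refine ⟨k, hne, fun u hu => ?_⟩
  -- `(1, g_f⁻¹ u g_f) = g⁻¹ (1, u) g`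
  have hconj : GLn.ofFinite n K ((GLn.sndHom n K g)⁻¹ * u * GLn.sndHom n K g) = g⁻¹ * GLn.ofFinite n K u * g := by
    rw [GLn.inv_mul_mul_eq_ofFinite (GLn.fstHom_ofFinite u) g, GLn.sndHom_ofFinite]
  rw [mem_finitePrincipalCongruenceLevel_iff, mem_principalCongruenceLevel_iff_forall_toLocal] at hu ⊢
  rw [hconj]
  refine ⟨?_, fun w => ?_⟩
  · rw [map_mul, map_mul, map_inv, GLn.fstHom_ofFinite, mul_one, inv_mul_cancel]
  rw [map_mul, map_mul, map_inv]
  by_cases hw : w ∈ S₀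
  · -- `w ∈ S₀`: `|𝔫₁|_w ≤ |𝔭_w^{k_w}|_w = exp(-k_w)`, and the depth `k w` was chosen for `g_w`
    refine hk w _ (valuedCongruenceSubgroup_mono (Fin n) ?_ (hu.2 w))
    have hdvd : w.asIdeal ^ k w ∣ 𝔫 * ∏ v ∈ S₀, v.asIdeal ^ k v :=
      (Finset.dvd_prod_of_mem (fun v => v.asIdeal ^ k v) hw).mul_left 𝔫
    exact (idealRadius_le_of_dvd K w hne hdvd).trans (idealRadius_pow_self K w (k w)).le
  · -- `w ∉ S₀`: `K_w(𝔫₁) ≤ K_w(𝔫)`, and `g_w ∈ GL_n(𝒪_w)` normalises `K_w(𝔫)`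
    have hgw : GLn.localPart n K w g ∈ valuedCongruenceSubgroup (Fin n) (1 : WithZero (Multiplicative ℤ)) := by
      rw [← glInt_adicCompletion_eq]
      exact hg w hw
    have hu' := valuedCongruenceSubgroup_mono (Fin n) (idealRadius_mono K w hne Ideal.mul_le_right) (hu.2 w)
    have h := BigHeckeGLn.conj_mem_valuedCongruenceSubgroup (idealRadius_le_one K w 𝔫) (inv_mem hgw) hu'
    rwa [inv_inv] at h

/-! ### 2. The multiplicity module: translates and the value formula -/

variable {μ : Measure (AdelicGroupData.gl n K).automorphicQuotient} [(AdelicGroupData.gl n K).IsAutomorphicMeasure μ]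
  {hcpt : isCompact_glFiniteIntegralLevel n K}
  {E : Type*} [NormedAddCommGroup E] [InnerProductSpace ℂ E] [CompleteSpace E]
  {τ : ContRepresentation ℂ (AutomorphyDatum.gl n K hcpt).arch.carrier E}

omit [CompleteSpace E] in
/-- **The translate `R((1, c)) ∘ S` of an intertwiner of level `U₀` has level `U₁` whenever
`c⁻¹ U₁ c ≤ U₀`** (its range lies in `Π^{c U₀ c⁻¹}`). [folklore] -/
theorem rightRegular_comp_mem_archIntertwinersLevel
    {W : ContRepresentation.ClosedSubrep ((AdelicGroupData.gl n K).rightRegular μ)}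
    {U₀ U₁ : Subgroup (GL (Fin n) (FiniteAdeleRing (𝓞 K) K))} (c : GL (Fin n) (FiniteAdeleRing (𝓞 K) K))
    (hc : ∀ u ∈ U₁, c⁻¹ * u * c ∈ U₀) {S : E →L[ℂ] (AdelicGroupData.gl n K).L2 μ}
    (hS : S ∈ archIntertwinersLevel hcpt τ W U₀) :
    (AdelicGroupData.gl n K).rightRegular μ (GLn.ofFinite n K c) ∘L S ∈ archIntertwinersLevel hcpt τ W U₁ := by
  -- adapted from `comp_mem_multiplicityModule` (`CuspidalRepFiniteComponent`)
  refine ⟨rightRegular_ofFinite_comp_mem_archIntertwiners hcpt hS.1 c, fun e => mem_levelPiece_iff.mpr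
    ⟨W.apply_mem _ (hS.1.1 e), fun u hu => ?_⟩⟩
  obtain ⟨u₀, hu₀, rfl⟩ : ∃ u₀ ∈ U₀, u = c * u₀ * c⁻¹ := ⟨c⁻¹ * u * c, hc u hu, by group⟩
  change (AdelicGroupData.gl n K).rightRegular μ (GLn.ofFinite n K (c * u₀ * c⁻¹))
      ((AdelicGroupData.gl n K).rightRegular μ (GLn.ofFinite n K c) (S e)) =
    (AdelicGroupData.gl n K).rightRegular μ (GLn.ofFinite n K c) (S e)
  have h1 : (AdelicGroupData.gl n K).rightRegular μ (GLn.ofFinite n K (c * u₀ * c⁻¹))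
      ((AdelicGroupData.gl n K).rightRegular μ (GLn.ofFinite n K c) (S e)) =
      (AdelicGroupData.gl n K).rightRegular μ (GLn.ofFinite n K (c * u₀ * c⁻¹) * GLn.ofFinite n K c) (S e) := by
    rw [rightRegular_mul_GL]; rfl
  rw [h1, ← map_mul, inv_mul_cancel_right, map_mul, rightRegular_mul_GL, ContinuousLinearMap.comp_apply,
    (mem_levelPiece_iff.mp (hS.2 e)).2 u₀ hu₀]

/-- **The value formula at a translate**: for a linear functional `ℓ` on the Gårding space of `Π`, a
level-`U₀` Gårding vector `y = Σ_i S_i e_i` (`e_i = S_i† y`, `eq_sum_apply_of_mem_gardingSubspace`) and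
ANY `x ∈ GL_n(𝔸_K)`, `ℓ(R(x) y) = Σ_i Φ_ℓ(x_f · S_i)(τ(x_∞) e_i)` (linearity and
`apply_toContRep_corestrictW_eq_transferMap`; no hypothesis on the level of `R(x) y`).
[cite: CogdellAnalyticTheory2004, §1.2] -/
theorem apply_toContRep_eq_sum_transferMap_finComponentRep (P : CuspidalAutomorphicRepGL n K μ)
    (hτu : τ.IsUnitary) (hτi : τ.IsTopIrreducible) (hτc : τ.IsStronglyContinuous)
    (hex : ∃ T ∈ archIntertwiners hcpt τ P.1, T ≠ 0)
    {U₀ : Subgroup (GL (Fin n) (FiniteAdeleRing (𝓞 K) K))}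
    (hU₀o : IsOpen (U₀ : Set (GL (Fin n) (FiniteAdeleRing (𝓞 K) K))))
    (hU₀c : IsCompact (U₀ : Set (GL (Fin n) (FiniteAdeleRing (𝓞 K) K))))
    {k : ℕ} {S : Fin k → E →L[ℂ] (AdelicGroupData.gl n K).L2 μ}
    (hS : ∀ i, S i ∈ archIntertwinersLevel hcpt τ P.1 U₀)
    (hSon : ∀ i j, schurCoeff (μ := μ) (S i) (S j) = if i = j then 1 else 0)
    (hspan : ∀ T ∈ archIntertwinersLevel hcpt τ P.1 U₀, T ∈ Submodule.span ℂ (Set.range S))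
    (ℓ : gardingSpace P.1 →ₗ[ℂ] ℂ) {y : P.1.toSubmodule} (hy : y ∈ gardingSubspace P.1 U₀)
    (hy' : y ∈ gardingSpace P.1) (x : GL (Fin n) (AdeleRing (𝓞 K) K)) :
    ℓ ⟨P.1.toContRep x y, toContRep_mem_gardingSpace x hy'⟩ =
      ∑ i, transferMap ℓ hτc
        (finComponentRep hcpt τ P.1 (GLn.sndHom n K x)
          ⟨S i, mem_multiplicityModule_of_mem_archIntertwinersLevel hU₀o hU₀c (hS i)⟩)
        ⟨τ (toArch hcpt (GLn.toMixed n K x)) (ContinuousLinearMap.adjoint (S i) (y : (AdelicGroupData.gl n K).L2 μ)),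
          apply_mem_archGardingSpace hτc _
            ((eq_sum_apply_of_mem_gardingSubspace P hτu hτi hτc hex hS hSon hspan hU₀o hU₀c hy).1 i)⟩ := by
  obtain ⟨hmem, hsum⟩ := eq_sum_apply_of_mem_gardingSubspace P hτu hτi hτc hex hS hSon hspan hU₀o hU₀c hy
  set T : Fin k → multiplicityModule hcpt τ P.1 := fun i =>
    ⟨S i, mem_multiplicityModule_of_mem_archIntertwinersLevel hU₀o hU₀c (hS i)⟩
  set e : Fin k → archGardingSpace hcpt τ := fun i =>
    ⟨ContinuousLinearMap.adjoint (S i) (y : (AdelicGroupData.gl n K).L2 μ), hmem i⟩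
  have hvec : (⟨P.1.toContRep x y, toContRep_mem_gardingSpace x hy'⟩ : gardingSpace P.1) = ∑ i,
      (⟨P.1.toContRep x (corestrictW (mem_archIntertwiners_of_mem_multiplicityModule (T i).2) (e i : E)),
        toContRep_mem_gardingSpace x
          (corestrictW_mem_gardingSpace_of_mem_multiplicityModule (T i).2 hτc (e i).2)⟩ : gardingSpace P.1) := by
    apply Subtype.ext
    apply Subtype.ext
    rw [Submodule.coe_sum, Submodule.coe_sum, ContRepresentation.ClosedSubrep.coe_toContRep_apply, hsum, _root_.map_sum]
    refine Finset.sum_congr rfl fun i _ => ?_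
    rw [ContRepresentation.ClosedSubrep.coe_toContRep_apply, coe_corestrictW_apply]
  rw [hvec, _root_.map_sum]
  refine Finset.sum_congr rfl fun i _ => ?_
  exact TransferMapLine.apply_toContRep_corestrictW_eq_transferMap ℓ hτc (T i) (e i) x _

/-! ### 3. The registered stub -/

/-- **STUB (W3, local content) — an initial pure tensor of level supported on `S₀` whose TRANSLATED
transferred Whittaker functional is non-zero.** For cuspidal `P` on `GL_n(𝔸_K)` (`n ≥ 1`) unramified off the
finite `S₀`, its archimedean component `τ` (any copy: `hex`), and a torus element `t` trivial at `S₀` whose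
components off `S₀` are Whittaker shifts correcting the conductor of `ψ_K` (`WhittakerShiftTorus`): some
intertwiner `S₁ ∈ π_f` of level `K_f(𝔫₁)`, `supp 𝔫₁ ⊆ S₀`, has `Φ_λ(t_f · S₁) ≠ 0`. Road: a level `𝔫` supported on
`S₀` with `π^{K(𝔫)} ≠ 0` (`Ssv.stub_ssv`); a left `K(𝔫)`-invariant test function `η` with `S_η f₀ ≠ 0`;
translated genericity and peeling of the non-integral places OFF `S₀`
(`exists_whittakerCoeff_smoothedForm_translate_ne_zero_forall_not_mem`): `W_{S_η f₀}(diag(t) g) ≠ 0` with `g`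
integral off `S₀`; the value formula `λ(R(diag(t) g) S_η f₀) = Σ_i Φ_λ(t_f g_f · S_i)(τ(g_∞) e_i)` in the
level decomposition at `K_f(𝔫)` (`exists_levelPiece_decomposition`,
`apply_toContRep_corestrictW_eq_transferMap`); a non-zero term gives `S₁ = g_f · S_i`, of level
`K_f(𝔫 ∏_{v ∈ S₀} 𝔭_v^{k_v})` (`exists_forall_conj_mem_finitePrincipalCongruenceLevel`).
[cite: CogdellAnalyticTheory2004, §1.1–§1.2 and §3.1 Thm. 3.3] [cite: Shalika1974, §5 Thm. 5.9] -/
theorem stub_initialVector_translate_ne_zero :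
    ∀ {n : ℕ} {K : Type} [Field K] [NumberField K]
      {μ : Measure (AdelicGroupData.gl n K).automorphicQuotient} [(AdelicGroupData.gl n K).IsAutomorphicMeasure μ]
      [MeasurableSpace (AdeleRing (𝓞 K) K)] [BorelSpace (AdeleRing (𝓞 K) K)]
      (hcpt : isCompact_glFiniteIntegralLevel n K) (_ : 1 ≤ n) (P : CuspidalAutomorphicRepGL n K μ)
      {E : Type} [NormedAddCommGroup E] [InnerProductSpace ℂ E] [CompleteSpace E]
      {τ : ContRepresentation ℂ (AutomorphyDatum.gl n K hcpt).arch.carrier E}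
      (_ : τ.IsUnitary) (_ : τ.IsTopIrreducible) (hτc : τ.IsStronglyContinuous)
      (_ : ∃ T ∈ archIntertwiners hcpt τ P.1, T ≠ 0)
      (ν₀ : Measure ↥(adelicUnipotent n K)) [IsHaarMeasure ν₀]
      (S₀ : Finset (HeightOneSpectrum (𝓞 K))) (_ : ∀ v ∉ S₀, IsUnramifiedAt P.1 v)
      (t : Fin n → ideleGroup K) (_ : ∀ v ∈ S₀, localComponent v (glDiagonal n (AdeleRing (𝓞 K) K) t) = 1)
      (_ : ∀ v ∉ S₀, ∃ (d : Fin n → (v.adicCompletion K)ˣ) (a : (v.adicCompletion K)ˣ),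
        localComponent v (glDiagonal n (AdeleRing (𝓞 K) K) t) = diagonalGL (Fin n) (v.adicCompletion K) d ∧
        (∀ i j : Fin n, (i : ℕ) + 1 = j → (d i : v.adicCompletion K) * ((d j)⁻¹ : (v.adicCompletion K)ˣ) = a) ∧
        (∀ c ∈ 𝒪[v.adicCompletion K], (adeleAddChar K).adicComponent v (a * c) = 1) ∧
        ∀ ϖ : v.adicCompletion K, Valued.v ϖ = WithZero.exp (-1 : ℤ) →
          ∃ c ∈ 𝒪[v.adicCompletion K], (adeleAddChar K).adicComponent v (a * (ϖ⁻¹ * c)) ≠ 1),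
    ∃ (𝔫₁ : Ideal (𝓞 K)) (_ : 𝔫₁ ≠ 0) (_ : ∀ w : HeightOneSpectrum (𝓞 K), w.asIdeal ∣ 𝔫₁ → w ∈ S₀)
      (S₁ : multiplicityModule hcpt τ P.1)
      (_ : (S₁ : E →L[ℂ] (AdelicGroupData.gl n K).L2 μ) ∈ archIntertwinersLevel hcpt τ P.1 (finitePrincipalCongruenceLevel n K 𝔫₁))
      (w : archGardingSpace hcpt τ),
      transferMap (whittakerFunctional ν₀ (continuous_adeleAddChar K) (ContRepresentation.Equiv.refl P.1.toContRep)) hτc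
        (finComponentRep hcpt τ P.1 (GLn.sndHom n K (glDiagonal n (AdeleRing (𝓞 K) K) t)) S₁) w ≠ 0 := by
  intro n K _ _ μ _ _ _ hcpt hn P E _ _ _ τ hτu hτi hτc hex ν₀ _ S₀ hS₀ t _ht₀ htψ
  classical
  -- (1) a level supported on `S₀` with a non-zero fixed vector
  obtain ⟨𝔫, h𝔫, hsupp, hbot⟩ := Ssv.stub_ssv P (S := (↑S₀ : Set (HeightOneSpectrum (𝓞 K))))
    fun v hv => hS₀ v fun h => hv (Finset.mem_coe.2 h)
  obtain ⟨f₀, hf₀K, hf₀0⟩ := Submodule.exists_mem_ne_zero_of_ne_bot hbot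
  have hUf₀ : ∀ u ∈ principalCongruenceLevel n K 𝔫, P.1.toContRep u f₀ = f₀ :=
    (ContRepresentation.ClosedSubrep.mem_fixedVectors _ _ _).1 hf₀K
  -- (2) a left `K(𝔫)`-invariant smoothing which does not kill it
  have hUl : principalCongruenceLevel n K 𝔫 ∈ (AutomorphyDatum.gl n K hcpt).finiteLevels := by
    rw [AutomorphyDatum.gl_finiteLevels]
    exact principalCongruenceLevel_mem_finiteLevelsGL_holds n K h𝔫
  have hε : 0 < ‖f₀‖ / 2 := half_pos (norm_pos_iff.2 hf₀0)
  obtain ⟨η, hη, hηK, -, hle⟩ :=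
    exists_adInvariant_isTestFunctionGL_norm_smoothedVector_sub_le hcpt P.1 hUl f₀ hUf₀ hε
  have hS0 : smoothedVector P.1 η f₀ ≠ 0 := by
    intro h0
    rw [h0, zero_sub, norm_neg] at hle
    linarith [norm_pos_iff.2 hf₀0]
  have hne0 : smoothedForm η ((f₀ : P.1.toSubmodule) : (AdelicGroupData.gl n K).L2 μ) ≠ 0 :=
    smoothedForm_ne_zero_of_smoothedVector_ne_zero hη.continuous hη.hasCompactSupport hS0
  -- (3) a Satake family off `S₀`; translated genericity and peeling off `S₀`
  obtain ⟨Sr, α, hSr, hα⟩ := P.exists_finset_isSatakeFamilyOf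
  have hα₀ : IsSatakeFamilyOf P (↑S₀ : Set (HeightOneSpectrum (𝓞 K))) α := hα.mono fun v hv => by
    by_contra hvS
    exact hSr v (Finset.mem_coe.1 hv) (hS₀ v fun h => hvS (Finset.mem_coe.2 h))
  have hS𝔫 : ∀ v ∉ (↑S₀ : Set (HeightOneSpectrum (𝓞 K))), ¬ v.asIdeal ∣ 𝔫 := fun v hv hdvd => hv (hsupp v hdvd)
  obtain ⟨g, hgint, hWg⟩ := exists_whittakerCoeff_smoothedForm_translate_ne_zero_forall_not_mem hn P hα₀ ν₀ h𝔫
    hS𝔫 hη hηK f₀ hne0 t fun v hv => htψ v fun h => hv (Finset.mem_coe.2 h)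
  -- (4) the level decomposition of `y = S_η f₀` at `U₀ = K_f(𝔫)`
  have hU₀o := isOpen_finitePrincipalCongruenceLevel n K h𝔫
  have hU₀c := isCompact_finitePrincipalCongruenceLevel n K h𝔫
  obtain ⟨k, S, hS, hSon, hspan, -⟩ := exists_levelPiece_decomposition hcpt P hτu hτi hex hU₀o hU₀c
  have hyg : smoothedVector P.1 η f₀ ∈ gardingSpace P.1 := smoothedVector_mem_gardingSpace hη f₀
  have hleft : ∀ u ∈ finitePrincipalCongruenceLevel n K 𝔫, ∀ x : GL (Fin n) (AdeleRing (𝓞 K) K),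
      η (GLn.ofFinite n K u * x) = η x := fun u hu x => hηK _ (mem_finitePrincipalCongruenceLevel_iff.1 hu) x
  have hysub : smoothedVector P.1 η f₀ ∈ gardingSubspace P.1 (finitePrincipalCongruenceLevel n K 𝔫) :=
    smoothedVector_mem_gardingSubspace hη hleft f₀
  -- (5) `λ(R(diag(t) g) y) = W_{S_η f₀}(diag(t) g) ≠ 0` is a sum of transferred functionals
  have hlam : whittakerFunctional ν₀ (continuous_adeleAddChar K) (ContRepresentation.Equiv.refl P.1.toContRep)
      ⟨P.1.toContRep (glDiagonal n (AdeleRing (𝓞 K) K) t * g) (smoothedVector P.1 η f₀),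
        toContRep_mem_gardingSpace _ hyg⟩ ≠ 0 := by
    rw [whittakerFunctional_toContRep_eq_whittakerCoeff ν₀ (continuous_adeleAddChar K) hyg
      (hasContRep_smoothedVector P.1 hη.continuous hη.hasCompactSupport f₀) _]
    exact hWg
  rw [apply_toContRep_eq_sum_transferMap_finComponentRep P hτu hτi hτc hex hU₀o hU₀c hS hSon hspan _ hysub hyg] at hlam
  obtain ⟨i₀, -, hi₀⟩ := Finset.exists_ne_zero_of_sum_ne_zero hlam
  -- (6) the level of the translate `g_f · S_{i₀}`
  obtain ⟨kk, hne, hkk⟩ := exists_forall_conj_mem_finitePrincipalCongruenceLevel S₀ h𝔫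
    (g := g) fun v hv => hgint v fun h => hv (Finset.mem_coe.1 h)
  set T₀ : multiplicityModule hcpt τ P.1 :=
    ⟨S i₀, mem_multiplicityModule_of_mem_archIntertwinersLevel hU₀o hU₀c (hS i₀)⟩
  set w : archGardingSpace hcpt τ :=
    ⟨τ (toArch hcpt (GLn.toMixed n K (glDiagonal n (AdeleRing (𝓞 K) K) t * g)))
        (ContinuousLinearMap.adjoint (S i₀) ((smoothedVector P.1 η f₀ : P.1.toSubmodule) : (AdelicGroupData.gl n K).L2 μ)),
      apply_mem_archGardingSpace hτc _
        ((eq_sum_apply_of_mem_gardingSubspace P hτu hτi hτc hex hS hSon hspan hU₀o hU₀c hysub).1 i₀)⟩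
  have hsplit : finComponentRep hcpt τ P.1 (GLn.sndHom n K (glDiagonal n (AdeleRing (𝓞 K) K) t * g)) T₀ =
      finComponentRep hcpt τ P.1 (GLn.sndHom n K (glDiagonal n (AdeleRing (𝓞 K) K) t))
        (finComponentRep hcpt τ P.1 (GLn.sndHom n K g) T₀) := by
    rw [map_mul, map_mul, Module.End.mul_apply]
  rw [hsplit] at hi₀
  exact ⟨𝔫 * ∏ v ∈ S₀, v.asIdeal ^ kk v, hne,
    fun w' hw' => mem_of_dvd_mul_prod_pow (fun w h => Finset.mem_coe.1 (hsupp w h)) kk hw',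
    finComponentRep hcpt τ P.1 (GLn.sndHom n K g) T₀,
    rightRegular_comp_mem_archIntertwinersLevel (GLn.sndHom n K g) hkk (hS i₀), w, hi₀⟩

end Summit.Langlands.Langlands.Theorems.InitialVectorTranslateNeZero
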